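import Summits.AnomalousDissipation.AnomalousDissipation.Theorems.TwodBoundedEnergyZeroMomentum.Negative.FirstShellRigidity
import Literature.Analysis.FluidPDE.LerayHopfTimeSliceTorus
import Literature.Analysis.FluidPDE.LerayHopfUniformEnergy
import Literature.Analysis.FluidPDE.CheskidovAssemblyTools
import Literature.Analysis.FluidPDE.LongTimeAverageNonneg

/-!
# An energy floor for the witnesses of `TwoAndHalfD.TwodBoundedEnergyZeroMomentum` (stmt-AnomalousDissipation-10786)

Negative-side support (cdisprove seat `refuter-cdisprove-stmt-AnomalousDissipation-10786-0`), companion of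
`Negative/FirstShellRigidity.lean` and `Negative/LoadBearing.lean`.  TIGHTNESS OF THE CEILING: what
the balance laws say about a witness of the crux ("some steady smooth divergence-free mean-zero
`g ≠ 0` admits, along `ν_j → 0`, zero-momentum global Leray–Hopf solutions with
`sup_j ⟨‖v_j‖²⟩ ≤ E`").  Testing the weak formulation with `g` itself
(`Torus.IsLerayHopfOn.integral_inner_eq_add_setIntegral`, Temam 1984 Ch. III (1.25)) and averaging
in time:

* `integral_norm_sq_le_affine` — affine-in-time energy bound `‖u(t)‖₂² ≤ a + b t` at zero
  momentum (energy inequality from `0` + the tree's Doering–Foias bound on `∫₀ᵗ ‖u‖₂²`);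
* `energy_floor` — for EVERY zero-momentum global Leray–Hopf solution under `g`:
  `‖g‖₂² ≤ D ⟨‖u‖²⟩ + (νK/2)(1 + ⟨‖u‖²⟩)` whenever `∑ᵢ‖∂ᵢ g‖ ≤ D`, `‖Δg‖ ≤ K` pointwise;
* `witness_ceiling_ge_floor` — hence along any witness family of the crux `‖g‖₂² ≤ D·E`: the
  constant can never be below `‖g‖₂²/‖∇g‖_∞`, and the flow cannot decorrelate from the force by
  becoming small.  This is ALL the balance laws give — an `O(1)` floor facing the sought `O(1)`
  ceiling, with no `ν⁻¹` growth — which is why they cannot refute the crux (printed open problem,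
  Constantin–Tarfulea–Vicol 2013, arXiv:1305.7089 p. 3; condensate numerics Gallet–Young 2013).

No new definitions.
-/

noncomputable section

open MeasureTheory Set Filter Topology UnitAddTorus
open scoped ENNReal NNReal InnerProductSpace RealInnerProductSpace

namespace Summit.AnomalousDissipation.AnomalousDissipation.Theorems.TwodBoundedEnergyZeroMomentum.Negative

open Literature.Analysis.FunctionSpaces Literature.Analysis.FunctionSpaces.Torus
open Literature.Analysis.FluidPDE Literature.Analysis.FluidPDE.Torus

variable {ν : ℝ} {g u₀ : (UnitAddTorus (Fin 2)) → (EuclideanSpace ℝ (Fin 2))}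
  {u : ℝ → (UnitAddTorus (Fin 2)) → (EuclideanSpace ℝ (Fin 2))}

/-- **Affine-in-time energy bound** for zero-momentum Leray–Hopf solutions under a smooth
mean-zero steady force: `∫ ‖u(t)‖² ≤ (2 + 1/(2π²ν)) ½‖u₀‖² · 2 … ` — precisely
`∫ ‖u(t)‖² ≤ (2E₀ + E₀/(2π²ν)) + (‖g‖₂² + ‖g‖₂²/(16π⁴ν²)) t`, `E₀ = ½‖u₀‖₂²` (energy
inequality from `0`, work `⟨g,u⟩ ≤ ½(‖g‖₂² + ‖u‖₂²)`, and the tree's linear bound on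
`∫₀ᵗ ‖u‖₂²`). [folklore] -/
theorem integral_norm_sq_le_affine (hν : 0 < ν) (hg : IsSmooth g) (hg0 : HasZeroMean g)
    (hu₀ : MemLp u₀ 2 volume) (h0 : HasZeroMean u₀)
    (hu : Torus.IsGlobalLerayHopf ν (fun _ => g) u₀ u) {t : ℝ} (ht : 0 < t) :
    ∫ x, ‖u t x‖ ^ 2 ≤ (2 * kineticEnergy u₀ + kineticEnergy u₀ / (2 * Real.pi ^ 2 * ν)) +
      ((∫ x, ‖g x‖ ^ 2) + (∫ x, ‖g x‖ ^ 2) / (16 * Real.pi ^ 4 * ν ^ 2)) * t := by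
  set E : ℝ → ℝ := fun τ => ∫ x, ‖u τ x‖ ^ 2 with hEdef
  set P : ℝ → ℝ := fun τ => ∫ x, ⟪g x, u τ x⟫ with hPdef
  set A2 : ℝ := ∫ x, ‖g x‖ ^ 2 with hA2
  -- energy inequality from `0`, dissipation dropped
  have hEn : kineticEnergy (u t) + ν * (∫⁻ τ in Ioo 0 t, eGradNormSq (u τ)).toReal ≤
      kineticEnergy u₀ + ∫ τ in (0 : ℝ)..t, P τ :=
    (hu t ht).energy_ineq_zero t ⟨ht.le, le_rfl⟩
  have hdiss : 0 ≤ ν * (∫⁻ τ in Ioo 0 t, eGradNormSq (u τ)).toReal :=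
    mul_nonneg hν.le ENNReal.toReal_nonneg
  -- integrability in time
  have hEint : IntervalIntegrable E volume 0 t :=
    (intervalIntegrable_iff_integrableOn_Ioc_of_le ht.le).2 (hu.integrableOn_integral_norm_sq ht)
  have hPint : IntervalIntegrable P volume 0 t := by
    have h1 : IntegrableOn (fun s => ∫ x, ⟪u s x, g x⟫) (Ioo 0 t) :=
      (hu t ht).integrableOn_integral_inner hg.continuous
    have h2 : P = fun s => ∫ x, ⟪u s x, g x⟫ := by
      funext s
      exact integral_congr_ae (ae_of_all _ fun x => real_inner_comm _ _)
    rw [intervalIntegrable_iff_integrableOn_Ioc_of_le ht.le, h2]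
    exact (integrableOn_Ioc_iff_integrableOn_Ioo).mpr h1
  -- the work bound
  have hP : ∀ τ ∈ Icc (0 : ℝ) t, P τ ≤ 2⁻¹ * (A2 + E τ) := fun τ hτ => by
    have h := integral_inner_le_young one_pos (hg.memLp 2) (hu.memLp_two hτ.1)
    have heq : (∫ x, ‖g x‖ ^ 2) / (2 * 1) + 1 / 2 * ∫ x, ‖u τ x‖ ^ 2 = 2⁻¹ * (A2 + E τ) := by
      simp only [hA2, hEdef]
      ring
    exact h.trans_eq heq
  have hIP : ∫ τ in (0 : ℝ)..t, P τ ≤ ∫ τ in (0 : ℝ)..t, 2⁻¹ * (A2 + E τ) :=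
    intervalIntegral.integral_mono_on ht.le hPint
      ((_root_.intervalIntegrable_const.add hEint).const_mul _) hP
  rw [intervalIntegral.integral_const_mul, intervalIntegral.integral_add _root_.intervalIntegrable_const hEint,
    intervalIntegral.integral_const, sub_zero, smul_eq_mul] at hIP
  -- the tree's linear bound on `∫₀ᵗ ‖u‖²`, at zero momentum
  have hL := hu.intervalIntegral_norm_sq_le hν hg hg0 ht
  have hmom : ∫ x, u 1 x = 0 := hasZeroMean_slice hg hg0 hu₀ h0 hu one_pos
  rw [hmom, norm_zero, zero_pow two_ne_zero, mul_zero, zero_add] at hL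
  have hEt : E t = 2 * kineticEnergy (u t) := by
    simp only [hEdef, kineticEnergy]
    ring
  have hK0 : 0 ≤ kineticEnergy u₀ := kineticEnergy_nonneg _
  have hA2_0 : 0 ≤ A2 := integral_nonneg fun _ => sq_nonneg _
  show E t ≤ _
  rw [hEt]
  nlinarith [hEn, hdiss, hIP, hL]

set_option maxHeartbeats 400000 in
/-- **ENERGY FLOOR for the witnesses of the crux.** Let `g` be smooth, divergence free and mean
zero, `ν > 0`, `u₀ ∈ L²` with zero mean, and `u` a global Leray–Hopf solution forced by `g`. If
`∑ᵢ ‖∂ᵢ g‖ ≤ D` and `‖Δg‖ ≤ K` pointwise, then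
`‖g‖₂² ≤ D ⟨‖u‖²⟩ + (νK/2)(1 + ⟨‖u‖²⟩)`.
Proof: test the weak formulation with `g` itself (`Torus.IsLerayHopfOn.integral_inner_eq_add_setIntegral`):
`⟨u(T),g⟩ - ⟨u₀,g⟩ = ∫₀ᵀ (⟨u,(u·∇)g⟩ + ν⟨u,Δg⟩ + ‖g‖₂²)`, bound the convective pairing by
`D‖u‖₂²` and the viscous one by `K‖u‖₁ ≤ ½K(1 + ‖u‖₂²)`, divide by `T` (the boundary terms are
`O(√T)` by `integral_norm_sq_le_affine`) and let `T → ∞` along the `limsup`.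
CONSEQUENCE FOR THE CRUX (tightness of the sought constant): along any witness family,
`E ≥ ⟨‖v_j‖²⟩ ≥ (‖g‖₂² - ν_jK/2)/(D + ν_jK/2) → ‖g‖₂²/D`: the bound `E` can never be smaller than
`‖g‖₂²/‖∇g‖_∞`, and the flow cannot decorrelate from the force by becoming small — the balance laws
pin the witness energy between an `O(1)` floor and the sought `O(1)` ceiling, with no `ν⁻¹` growth
(which is why they cannot kill the crux). [folklore] -/
theorem energy_floor (hν : 0 < ν) (hg : IsSmooth g) (hgd : IsDivFree g) (hg0 : HasZeroMean g)
    (hu₀ : MemLp u₀ 2 volume) (h0 : HasZeroMean u₀)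
    (hu : Torus.IsGlobalLerayHopf ν (fun _ => g) u₀ u)
    {D : ℝ} (hD : ∀ x, ∑ i, ‖partialDeriv i g x‖ ≤ D) {K : ℝ} (hK0 : 0 ≤ K)
    (hK : ∀ x, ‖laplacian g x‖ ≤ K) :
    ∫ x, ‖g x‖ ^ 2 ≤ D * meanEnergy u + ν * K / 2 * (1 + meanEnergy u) := by
  set E : ℝ → ℝ := fun τ => ∫ x, ‖u τ x‖ ^ 2 with hEdef
  set A2 : ℝ := ∫ x, ‖g x‖ ^ 2 with hA2
  set Φ : ℝ → ℝ := fun s => ∫ x, ⟪u s x, g x⟫ with hΦ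
  set B₀ : ℝ := |∫ x, ⟪u₀ x, g x⟫| with hB₀
  set c : ℝ := D + ν * K / 2 with hc
  have hD0 : 0 ≤ D := (Finset.sum_nonneg fun i _ => norm_nonneg _).trans (hD 0)
  have hc0 : 0 ≤ c := by positivity
  have hA2_0 : 0 ≤ A2 := integral_nonneg fun _ => sq_nonneg _
  have hE0 : ∀ τ, 0 ≤ E τ := fun τ => integral_nonneg fun _ => sq_nonneg _
  have hB₀0 : 0 ≤ B₀ := abs_nonneg _
  have hfm : ∀ T : ℝ, AEStronglyMeasurable (stLift fun _ : ℝ => g)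
      (volume.restrict (Ioo 0 T ×ˢ univ)) := fun T => aestronglyMeasurable_stLift_steady hg.continuous _
  have hf₂ : ∀ T : ℝ, ∫⁻ _ in Ioo (0 : ℝ) T, ∫⁻ x, ‖g x‖ₑ ^ 2 < ⊤ := fun T =>
    lintegral_Ioo_lintegral_enorm_sq_steady_lt_top (hg.memLp 2) T
  -- STEP 1: the Cesàro inequality `A2·T ≤ |Φ T| + B₀ + (νK/2) T + c ∫₀ᵀ E`
  have step1 : ∀ T, 0 < T → A2 * T ≤ |Φ T| + B₀ + ν * K / 2 * T + c * ∫ s in Ioc 0 T, E s := by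
    intro T hT
    set flux : ℝ → ℝ := fun s =>
      ∫ x, (⟪u s x, convect (u s) g x⟫ + ν * ⟪u s x, laplacian g x⟫ + ⟪g x, g x⟫) with hflux
    have hid : Φ T = (∫ x, ⟪u₀ x, g x⟫) + ∫ s in Ioc 0 T, flux s :=
      (hu T hT).integral_inner_eq_add_setIntegral hT (hfm T) (hf₂ T) hg hgd ⟨hT, le_rfl⟩
    have hlow : ∀ s ∈ Ioc (0 : ℝ) T, (A2 - ν * K / 2) - c * E s ≤ flux s := by
      intro s hs
      have hmem : MemLp (u s) 2 volume := hu.memLp_two hs.1.le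
      have i1 := integrable_inner_convect_self hmem hg
      have i2 : Integrable (fun x => ⟪u s x, laplacian g x⟫) volume :=
        integrable_inner_of_continuous (hmem.integrable one_le_two) hg.laplacian.continuous
      have i3 : Integrable (fun x => ⟪g x, g x⟫) volume :=
        integrable_inner_of_continuous hg.integrable hg.continuous
      have i12 : Integrable (fun x => ⟪u s x, convect (u s) g x⟫ + ν * ⟪u s x, laplacian g x⟫)
          volume := i1.add (i2.const_mul ν)
      have hsplit : flux s = (∫ x, ⟪u s x, convect (u s) g x⟫) +
          ν * (∫ x, ⟪u s x, laplacian g x⟫) + A2 := by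
        simp only [hflux]
        rw [integral_add i12 i3, integral_add i1 (i2.const_mul ν), integral_const_mul]
        congr 1
        simp only [hA2]
        exact integral_congr_ae (ae_of_all _ fun x => real_inner_self_eq_norm_sq _)
      have b1 : |∫ x, ⟪u s x, convect (u s) g x⟫| ≤ D * E s :=
        abs_integral_inner_convect_self_le hmem hg hD
      have b2 : |∫ x, ⟪u s x, laplacian g x⟫| ≤ K * (2⁻¹ * (1 + E s)) :=
        (abs_integral_inner_le_of_norm_le (hmem.integrable one_le_two) hK).trans
          (mul_le_mul_of_nonneg_left (integral_norm_le_of_memLp_two hmem) hK0)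
      rw [hsplit]
      have hb1 := neg_abs_le (∫ x, ⟪u s x, convect (u s) g x⟫)
      have hb2 := neg_abs_le (∫ x, ⟪u s x, laplacian g x⟫)
      have hb2' : -(K * (2⁻¹ * (1 + E s))) ≤ ∫ x, ⟪u s x, laplacian g x⟫ := by linarith
      have hb3 : ν * -(K * (2⁻¹ * (1 + E s))) ≤ ν * ∫ x, ⟪u s x, laplacian g x⟫ :=
        mul_le_mul_of_nonneg_left hb2' hν.le
      simp only [hc]
      linarith
    have hfluxInt : IntegrableOn flux (Ioc 0 T) :=
      (integrableOn_Ioc_iff_integrableOn_Ioo).2 ((hu T hT).integrableOn_flux (hfm T) (hf₂ T) hg)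
    have hEInt : IntegrableOn E (Ioc 0 T) := hu.integrableOn_integral_norm_sq hT
    have hconstInt : IntegrableOn (fun _ : ℝ => A2 - ν * K / 2) (Ioc 0 T) :=
      integrableOn_const (hs := measure_Ioc_lt_top.ne)
    have hlowInt : IntegrableOn (fun s => (A2 - ν * K / 2) - c * E s) (Ioc 0 T) :=
      hconstInt.sub (hEInt.const_mul c)
    have hmono := setIntegral_mono_on hlowInt hfluxInt measurableSet_Ioc hlow
    have hcomp : ∫ s in Ioc 0 T, ((A2 - ν * K / 2) - c * E s) =
        (A2 - ν * K / 2) * T - c * ∫ s in Ioc 0 T, E s := by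
      rw [integral_sub hconstInt (hEInt.const_mul c), setIntegral_const, integral_const_mul,
        Real.volume_real_Ioc_of_le hT.le, sub_zero, smul_eq_mul, mul_comm]
    have hΦT := le_abs_self (Φ T)
    have hΦ0 := neg_abs_le (∫ x, ⟪u₀ x, g x⟫)
    rw [hcomp] at hmono
    simp only [hB₀]
    linarith
  -- STEP 2: the boundary terms are `O(√T)`
  obtain ⟨a, b, ha, hb, hEab⟩ : ∃ a b : ℝ, 0 ≤ a ∧ 0 ≤ b ∧ ∀ t, 0 < t → E t ≤ a + b * t := by
    refine ⟨2 * kineticEnergy u₀ + kineticEnergy u₀ / (2 * Real.pi ^ 2 * ν),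
      A2 + A2 / (16 * Real.pi ^ 4 * ν ^ 2), ?_, ?_, fun t ht =>
      integral_norm_sq_le_affine hν hg hg0 hu₀ h0 hu ht⟩
    · have := kineticEnergy_nonneg u₀
      positivity
    · positivity
  set R : ℝ := Real.sqrt (a + b) * Real.sqrt A2 + B₀ with hR
  have hR0 : 0 ≤ R := by positivity
  have step2 : ∀ T, 1 ≤ T → |Φ T| + B₀ ≤ R * Real.sqrt T := by
    intro T hT
    have hT0 : 0 < T := one_pos.trans_le hT
    have h1 : |Φ T| ≤ Real.sqrt (E T) * Real.sqrt A2 :=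
      abs_integral_inner_le_sqrt_mul_sqrt (hu.memLp_two hT0.le) (hg.memLp 2)
    have h2 : E T ≤ (a + b) * T := by
      have := hEab T hT0
      nlinarith
    have h3 : Real.sqrt (E T) ≤ Real.sqrt (a + b) * Real.sqrt T := by
      rw [← Real.sqrt_mul (by positivity)]
      exact Real.sqrt_le_sqrt h2
    have h4 : 1 ≤ Real.sqrt T := by
      rw [← Real.sqrt_one]
      exact Real.sqrt_le_sqrt hT
    have h5 : B₀ ≤ B₀ * Real.sqrt T := le_mul_of_one_le_right hB₀0 h4
    have hA : 0 ≤ Real.sqrt A2 := Real.sqrt_nonneg _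
    calc |Φ T| + B₀ ≤ Real.sqrt (a + b) * Real.sqrt T * Real.sqrt A2 + B₀ * Real.sqrt T := by
          gcongr
          exact h1.trans (mul_le_mul_of_nonneg_right h3 hA)
      _ = R * Real.sqrt T := by
          simp only [hR]
          ring
  -- STEP 3: pass to the `limsup`
  set M : ℝ := meanEnergy u with hM
  have hM0 : 0 ≤ M := longTimeAvgSup_nonneg fun t => integral_nonneg fun _ => sq_nonneg _
  have hlimsup : limsup (timeMean E) atTop = M := by
    rw [hM, meanEnergy_eq_longTimeAvgSup, longTimeAvgSup]
  have hbdd : IsBoundedUnder (· ≤ ·) atTop (timeMean E) :=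
    ⟨_, (eventually_ge_atTop (1 : ℝ)).mono fun T hT => hu.timeMean_norm_sq_le hν hg hg0 hT⟩
  by_contra hcon
  push Not at hcon
  set δ : ℝ := A2 - (D * M + ν * K / 2 * (1 + M)) with hδ
  have hδ0 : 0 < δ := by
    simp only [hδ]
    linarith
  set ε : ℝ := δ / (2 * (1 + c)) with hε
  have hε0 : 0 < ε := by positivity
  have hεc : ε * (2 * (1 + c)) = δ := div_mul_cancel₀ δ (by positivity)
  have hev1 : ∀ᶠ T in atTop, timeMean E T < M + ε :=
    eventually_lt_of_limsup_lt (by rw [hlimsup]; linarith) hbdd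
  have hev2 : ∀ᶠ T in atTop, max 1 ((R / ε) ^ 2) ≤ T := eventually_ge_atTop _
  obtain ⟨T, hT1, hT2⟩ := (hev1.and hev2).exists
  have hT1' : 1 ≤ T := (le_max_left _ _).trans hT2
  have hT0 : 0 < T := one_pos.trans_le hT1'
  -- boundary ≤ ε T
  have hsqrtT : R / ε ≤ Real.sqrt T := by
    have h := Real.sqrt_le_sqrt ((le_max_right _ _).trans hT2)
    rwa [Real.sqrt_sq (by positivity)] at h
  have hbdry : |Φ T| + B₀ ≤ ε * T := by
    refine (step2 T hT1').trans ?_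
    have h1 : R ≤ ε * Real.sqrt T := by
      rw [div_le_iff₀ hε0] at hsqrtT
      linarith
    have h2 : R * Real.sqrt T ≤ ε * Real.sqrt T * Real.sqrt T :=
      mul_le_mul_of_nonneg_right h1 (Real.sqrt_nonneg _)
    rwa [mul_assoc, Real.mul_self_sqrt hT0.le] at h2
  -- the mean: `∫₀ᵀ E = T · timeMean E T`
  have hmean : ∫ s in Ioc 0 T, E s = T * timeMean E T := by
    rw [timeMean, intervalIntegral.integral_of_le hT0.le, ← mul_assoc, mul_inv_cancel₀ hT0.ne', one_mul]
  have hI : c * ∫ s in Ioc 0 T, E s ≤ c * (T * (M + ε)) := by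
    rw [hmean]
    exact mul_le_mul_of_nonneg_left (mul_le_mul_of_nonneg_left hT1.le hT0.le) hc0
  have key := step1 T hT0
  have key2 : A2 * T ≤ (ε + ν * K / 2 + c * (M + ε)) * T := by nlinarith
  have key3 : A2 ≤ ε + ν * K / 2 + c * (M + ε) := le_of_mul_le_mul_right key2 hT0
  have : δ ≤ ε * (1 + c) := by
    simp only [hδ, hc] at key3 ⊢
    nlinarith
  nlinarith

/-- **The ceiling is at least the floor.** In the notation of the crux: if `g` (smooth,
divergence free, mean zero, `∑ᵢ‖∂ᵢ g‖ ≤ D`, `‖Δg‖ ≤ K` pointwise) admits zero-momentum global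
Leray–Hopf families along `ν_j → 0⁺` with `⟨‖v_j‖²⟩ ≤ E` for all `j`, then `‖g‖₂² ≤ D·E`.
So the constant of any witness of the crux obeys `E ≥ ‖g‖₂²/‖∇g‖_∞`: bounded-energy witnesses
live at energies comparable to the sweeping scale `‖g‖₂/‖∇g‖_∞` or above, never below (and in
particular the witness flow cannot decorrelate from `g` by being small). [folklore] -/
theorem witness_ceiling_ge_floor (hg : IsSmooth g) (hgd : IsDivFree g) (hg0 : HasZeroMean g)
    {D : ℝ} (hD : ∀ x, ∑ i, ‖partialDeriv i g x‖ ≤ D) {K : ℝ} (hK0 : 0 ≤ K)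
    (hK : ∀ x, ‖laplacian g x‖ ≤ K) {νs : ℕ → ℝ} {v₀ : ℕ → (UnitAddTorus (Fin 2)) → (EuclideanSpace ℝ (Fin 2))}
    {v : ℕ → ℝ → (UnitAddTorus (Fin 2)) → (EuclideanSpace ℝ (Fin 2))} (hν : ∀ j, 0 < νs j) (hν0 : Tendsto νs atTop (𝓝 0))
    (hdata : ∀ j, MemLp (v₀ j) 2 volume ∧ HasZeroMean (v₀ j))
    (hLH : ∀ j, Torus.IsGlobalLerayHopf (νs j) (fun _ => g) (v₀ j) (v j)) {E : ℝ}
    (hE : ∀ j, meanEnergy (v j) ≤ E) :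
    ∫ x, ‖g x‖ ^ 2 ≤ D * E := by
  have hD0 : 0 ≤ D := (Finset.sum_nonneg fun i _ => norm_nonneg _).trans (hD 0)
  have hM0 : ∀ j, 0 ≤ meanEnergy (v j) := fun j =>
    longTimeAvgSup_nonneg fun t => integral_nonneg fun _ => sq_nonneg _
  have hE0 : 0 ≤ E := (hM0 0).trans (hE 0)
  have hj : ∀ j, ∫ x, ‖g x‖ ^ 2 ≤ D * E + νs j * (K / 2 * (1 + E)) := fun j => by
    have h := energy_floor (hν j) hg hgd hg0 (hdata j).1 (hdata j).2 (hLH j) hD hK0 hK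
    have h1 : D * meanEnergy (v j) ≤ D * E := mul_le_mul_of_nonneg_left (hE j) hD0
    have h2 : νs j * K / 2 * (1 + meanEnergy (v j)) ≤ νs j * (K / 2 * (1 + E)) := by
      have h3 : K / 2 * (1 + meanEnergy (v j)) ≤ K / 2 * (1 + E) :=
        mul_le_mul_of_nonneg_left (by linarith [hE j]) (by positivity)
      have h4 := mul_le_mul_of_nonneg_left h3 (hν j).le
      linarith [h4]
    linarith
  have hlim : Tendsto (fun j => D * E + νs j * (K / 2 * (1 + E))) atTop (𝓝 (D * E)) := by
    have := (hν0.mul_const (K / 2 * (1 + E))).const_add (D * E)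
    simpa using this
  exact ge_of_tendsto' hlim hj

end Summit.AnomalousDissipation.AnomalousDissipation.Theorems.TwodBoundedEnergyZeroMomentum.Negative

end
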